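import Summits.HubbardSuperconductivity.HubbardSuperconductivity.Theorems.BalabanIRBirComplexStableXYRCoreVariance
import Summits.HubbardSuperconductivity.HubbardSuperconductivity.Theorems.BalabanIRBirComplexStableXYFixedVolumeAction
import HarnessLib

/-!
# Inversion symmetry (P) of the window action and the second moment on the log-concave core

Support file for crux `BirComplexStableXYR` (stmt-HubbardSuperconductivity-14845) of route
`BalabanIR`, line `log-concave-core-bounded-phase`.

`CoreBL.stub_coreVarianceBL` (file `…RCoreVariance`) bounds the VARIANCE of a slice difference
`h = (ext v)(x,0) − (ext v)(y,0)` under the pinned modulus weight `w = e^{−K Re A(ext v)}`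
restricted to the global convex core, by `256/(K c₀)`, for every (U1)+(N)+(A ≤ B)+(C) table.
The line consumes the SECOND MOMENT (`1 − cos h ≤ h²/2`).  This file supplies the missing mean:
the inversion-evenness hypothesis (P) of the crux, `c (n ∘ (rev, rev, id)) = c n`, makes the full
complex window action invariant under the spatial inversions `(x,t) ↦ (a − x, t)` of the torus
(`sum_genF_sinv`: the window at base `s` is carried onto the window at base
`(a − s.1 − (r−1)(1,1), s.2)` with `(rev,rev,id)`-permuted offsets, and `genF c (φ ∘ (rev,rev,id)) = genF c φ`,
`genF_comp_winv`).  With `a = x + y` the inversion swaps `(x,0) ↔ (y,0)`, so `h ↦ −h`, while the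
weight, the core and (through the volume-preserving linear involution it induces on the pinned
space `ℝ^{Λ∖0}`) the Lebesgue measure are invariant: `∫_Core h·w = 0` (`core_mean_zero`, needs only
(U1)+(P)).  Hence `∫_Core h² w ≤ 256/(K c₀) · ∫_Core w` for every admissible (P)-table
(`stub_coreSecondMoment`, registered let-free on the crux item).

No new definitions; fully proved, standard axioms.
-/

noncomputable section

namespace Summit.HubbardSuperconductivity.HubbardSuperconductivity.Theorems

namespace CoreBL

open scoped BigOperators
open MeasureTheory Summit.HubbardSuperconductivity.BirComplexStableXYNegative
open Literature.Probability.LatticeModels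

variable {r : ℕ}

/-! ## Window level: (P) makes `genF` invariant under the offset inversion `(rev, rev, id)` -/

/-- The offset inversion `(rev, rev, id)` of the window is an involution. [folklore] -/
theorem winv_winv (w : W r) :
    ((Fin.rev (Fin.rev w.1, Fin.rev w.2.1, w.2.2).1, Fin.rev (Fin.rev w.1, Fin.rev w.2.1, w.2.2).2.1,
      (Fin.rev w.1, Fin.rev w.2.1, w.2.2).2.2) : W r) = w := by
  obtain ⟨w₁, w₂, w₃⟩ := w
  simp [Fin.rev_rev]

/-- Re-indexing the pairing by the offset inversion. [folklore] -/
theorem frq_comp_winv (n : Freq r) (φ : W r → ℝ) :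
    (∑ w : W r, (n w : ℝ) * φ (Fin.rev w.1, Fin.rev w.2.1, w.2.2)) =
      ∑ w : W r, (n (Fin.rev w.1, Fin.rev w.2.1, w.2.2) : ℝ) * φ w := by
  have hinv : Function.Involutive (fun w : W r => ((Fin.rev w.1, Fin.rev w.2.1, w.2.2) : W r)) :=
    fun w => winv_winv w
  refine Fintype.sum_equiv (hinv.toPerm _) _ _ fun w => ?_
  simp only [Function.Involutive.coe_toPerm]
  rw [winv_winv]

/-- **(P) ⇒ `genF c (φ ∘ (rev,rev,id)) = genF c φ`.** [folklore] -/
theorem genF_comp_winv (c : Table r)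
    (hP : ∀ n : Freq r, c (fun w => n (Fin.rev w.1, Fin.rev w.2.1, w.2.2)) = c n) (φ : W r → ℝ) :
    genF c (fun w => φ (Fin.rev w.1, Fin.rev w.2.1, w.2.2)) = genF c φ := by
  have hinv : Function.Involutive
      (fun n : Freq r => fun w : W r => n (Fin.rev w.1, Fin.rev w.2.1, w.2.2)) := by
    intro n; funext w
    simp only
    rw [winv_winv]
  set e : Freq r ≃ Freq r := hinv.toPerm _ with he
  have hc : Finsupp.equivMapDomain e c = c := by
    ext n
    rw [Finsupp.equivMapDomain_apply, Function.Involutive.toPerm_symm,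
      Function.Involutive.coe_toPerm]
    exact hP n
  have h1 : genF c (fun w => φ (Fin.rev w.1, Fin.rev w.2.1, w.2.2)) =
      c.sum (fun n a => a * Complex.exp (Complex.I * ((∑ w, ((e n) w : ℝ) * φ w : ℝ) : ℂ))) := by
    unfold genF
    refine Finsupp.sum_congr fun n _ => ?_
    rw [frq_comp_winv]
    rfl
  rw [h1, ← Finsupp.sum_equivMapDomain e c
    (fun n a => a * Complex.exp (Complex.I * ((∑ w, (n w : ℝ) * φ w : ℝ) : ℂ))), hc]
  rfl

/-! ## Torus level: the spatial inversion `(x,t) ↦ (a − x, t)` permutes the windows -/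

section Torus

variable {L M : ℕ} [NeZero L] [NeZero M]

omit [NeZero L] [NeZero M] in
/-- The inversion `(x,t) ↦ (a − x, t)` carries the window at base `s` with offset `w` to the
window at base `(a − s.1 − (r−1)(1,1), s.2)` with offset `(rev, rev, id) w`. [folklore] -/
theorem sinv_sh (a : TorusSite 2 L) (s : Λ L M) (w : W r) :
    ((a - (sh L M s w).1, (sh L M s w).2) : Λ L M) =
      sh L M (a - s.1 - ![(((r - 1 : ℕ) : ZMod L)), (((r - 1 : ℕ) : ZMod L))], s.2)
        (Fin.rev w.1, Fin.rev w.2.1, w.2.2) := by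
  have hw1 : ((Fin.rev w.1 : ℕ) : ZMod L) = ((r - 1 : ℕ) : ZMod L) - ((w.1 : ℕ) : ZMod L) := by
    have hle : (w.1 : ℕ) ≤ r - 1 := by have := w.1.isLt; omega
    have : ((Fin.rev w.1 : ℕ)) = r - 1 - (w.1 : ℕ) := by rw [Fin.val_rev]; omega
    rw [this, Nat.cast_sub hle]
  have hw2 : ((Fin.rev w.2.1 : ℕ) : ZMod L) = ((r - 1 : ℕ) : ZMod L) - ((w.2.1 : ℕ) : ZMod L) := by
    have hle : (w.2.1 : ℕ) ≤ r - 1 := by have := w.2.1.isLt; omega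
    have : ((Fin.rev w.2.1 : ℕ)) = r - 1 - (w.2.1 : ℕ) := by rw [Fin.val_rev]; omega
    rw [this, Nat.cast_sub hle]
  have hv : (![((Fin.rev w.1 : ℕ) : ZMod L), ((Fin.rev w.2.1 : ℕ) : ZMod L)] : TorusSite 2 L) =
      ![(((r - 1 : ℕ) : ZMod L)), (((r - 1 : ℕ) : ZMod L))] - ![((w.1 : ℕ) : ZMod L), ((w.2.1 : ℕ) : ZMod L)] := by
    rw [hw1, hw2, Matrix.cons_sub_cons, Matrix.cons_sub_cons, Matrix.empty_sub_empty]
  simp only [sh, Prod.mk.injEq, and_true]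
  rw [hv]
  abel

omit [NeZero L] [NeZero M] in
/-- The base-point map `s ↦ (a − s.1 − d, s.2)` is an involution. [folklore] -/
theorem sinv_base_invol (a d : TorusSite 2 L) (s : Λ L M) :
    ((a - (a - s.1 - d, s.2).1 - d, (a - s.1 - d, s.2).2) : Λ L M) = s := by
  obtain ⟨s₁, s₂⟩ := s
  simp only [Prod.mk.injEq, and_true]
  abel

/-- **(P) ⇒ the summed window action is invariant under spatial inversions of the torus.**
For every field `θ` and every `a`, `Σ_s F(θ ∘ σ_a ∘ sh s) = Σ_s F(θ ∘ sh s)` with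
`σ_a (x,t) = (a − x, t)`. [folklore] -/
theorem sum_genF_sinv (c : Table r)
    (hP : ∀ n : Freq r, c (fun w => n (Fin.rev w.1, Fin.rev w.2.1, w.2.2)) = c n)
    (a : TorusSite 2 L) (θ : Λ L M → ℝ) :
    (∑ s : Λ L M, genF c (fun w => θ (a - (sh L M s w).1, (sh L M s w).2))) =
      ∑ s : Λ L M, genF c (fun w => θ (sh L M s w)) := by
  set d : TorusSite 2 L := ![(((r - 1 : ℕ) : ZMod L)), (((r - 1 : ℕ) : ZMod L))] with hd
  have hinv : Function.Involutive (fun s : Λ L M => ((a - s.1 - d, s.2) : Λ L M)) :=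
    fun s => sinv_base_invol a d s
  refine Fintype.sum_equiv (hinv.toPerm _) _ _ fun s => ?_
  simp only [Function.Involutive.coe_toPerm]
  have h1 : (fun w : W r => θ (a - (sh L M s w).1, (sh L M s w).2)) =
      fun w : W r => (fun w' : W r => θ (sh L M (a - s.1 - d, s.2) w'))
        (Fin.rev w.1, Fin.rev w.2.1, w.2.2) := by
    funext w
    simp only
    rw [sinv_sh a s w]
  rw [h1]
  exact genF_comp_winv c hP (fun w' => θ (sh L M (a - s.1 - d, s.2) w'))

/-- The complete `ℓ²`-oscillation of a window is invariant under the offset inversion. [folklore] -/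
theorem osc_comp_winv (ψ : W r → ℝ) :
    (∑ w : W r, ∑ w' : W r,
        (ψ (Fin.rev w.1, Fin.rev w.2.1, w.2.2) - ψ (Fin.rev w'.1, Fin.rev w'.2.1, w'.2.2)) ^ 2) =
      ∑ w : W r, ∑ w' : W r, (ψ w - ψ w') ^ 2 := by
  have hinv : Function.Involutive (fun w : W r => ((Fin.rev w.1, Fin.rev w.2.1, w.2.2) : W r)) :=
    fun w => winv_winv w
  refine Fintype.sum_equiv (hinv.toPerm _) _ _ fun w => ?_
  refine Fintype.sum_equiv (hinv.toPerm _) _ _ fun w' => ?_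
  simp only [Function.Involutive.coe_toPerm]

omit [NeZero L] [NeZero M] in
/-- **(P)-symmetry of the global core.**  The family of window oscillations of `θ ∘ σ_a` is the
family of window oscillations of `θ`, re-indexed by the base-point involution; in particular the
predicate "every window oscillation is `≤ a₀`" is `σ_a`-invariant. [folklore] -/
theorem core_sinv_iff (a : TorusSite 2 L) (θ : Λ L M → ℝ) (a₀ : ℝ) :
    (∀ s : Λ L M, ∑ w : W r, ∑ w' : W r,
        (θ (a - (sh L M s w).1, (sh L M s w).2) - θ (a - (sh L M s w').1, (sh L M s w').2)) ^ 2 ≤ a₀) ↔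
      ∀ s : Λ L M, ∑ w : W r, ∑ w' : W r, (θ (sh L M s w) - θ (sh L M s w')) ^ 2 ≤ a₀ := by
  set d : TorusSite 2 L := ![(((r - 1 : ℕ) : ZMod L)), (((r - 1 : ℕ) : ZMod L))] with hd
  have key : ∀ s : Λ L M, (∑ w : W r, ∑ w' : W r,
      (θ (a - (sh L M s w).1, (sh L M s w).2) - θ (a - (sh L M s w').1, (sh L M s w').2)) ^ 2) =
      ∑ w : W r, ∑ w' : W r,
        (θ (sh L M (a - s.1 - d, s.2) w) - θ (sh L M (a - s.1 - d, s.2) w')) ^ 2 := by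
    intro s
    rw [← osc_comp_winv (fun w' => θ (sh L M (a - s.1 - d, s.2) w'))]
    refine Finset.sum_congr rfl fun w _ => Finset.sum_congr rfl fun w' _ => ?_
    rw [sinv_sh a s w, sinv_sh a s w']
  constructor
  · intro h s
    have := h (a - s.1 - d, s.2)
    rw [key, sinv_base_invol a d s] at this
    exact this
  · intro h s
    rw [key]
    exact h _

end Torus

/-! ## Pinned space: the induced volume-preserving involution and the vanishing mean -/

section Pinned

variable {L M : ℕ} [NeZero L] [NeZero M]

/-- **Mean zero on the core by (U1)+(P).**  For a (U1) table with the inversion evenness (P),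
every `K`, every core threshold `a₀`, all `L, M` and all slice sites `x, y`: the pinned modulus
weight restricted to the global core integrates the slice difference to zero,
`∫_Core ((ext v)(x,0) − (ext v)(y,0)) · e^{−K Re A(ext v)} dv = 0`.  Proof: the spatial inversion
`(z,t) ↦ (x + y − z, t)` swaps the two sites, preserves `Re A` (`sum_genF_sinv` + (U1)) and the core
(`core_sinv_iff`), and induces a linear involution of the pinned space `ℝ^{Λ∖0}` (re-pinning at `0`),
which has `|det| = 1` and hence preserves Lebesgue measure. [folklore] -/
theorem core_mean_zero (c : Table r) (hU1 : ∀ n ∈ c.support, ∑ w, n w = 0)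
    (hP : ∀ n : Freq r, c (fun w => n (Fin.rev w.1, Fin.rev w.2.1, w.2.2)) = c n)
    (K a₀ : ℝ) (x y : TorusSite 2 L)
    (xt : ({i : Λ L M // i ≠ 0} → ℝ) → Λ L M → ℝ)
    (hxt : ∀ v i, xt v i = if h : i = (0 : Λ L M) then (0 : ℝ) else v ⟨i, h⟩) :
    ∫ v in {v | ∀ s : Λ L M, ∑ w : W r, ∑ w' : W r,
        (xt v (sh L M s w) - xt v (sh L M s w')) ^ 2 ≤ a₀},
      (xt v (x, 0) - xt v (y, 0)) *
        Real.exp (-(K * ∑ s : Λ L M, (genF c (fun w => xt v (sh L M s w))).re)) = 0 := by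
  classical
  -- the inversion of the torus swapping `(x,0)` and `(y,0)`
  set a : TorusSite 2 L := x + y with ha
  set σ : Λ L M → Λ L M := fun i => (a - i.1, i.2) with hσ
  have hσσ : ∀ i, σ (σ i) = i := by
    intro i; obtain ⟨i₁, i₂⟩ := i
    simp only [hσ, Prod.mk.injEq, and_true]
    abel
  have hσx : σ ((x, 0) : Λ L M) = (y, 0) := by
    simp only [hσ, ha, Prod.mk.injEq, and_true]; abel
  have hσy : σ ((y, 0) : Λ L M) = (x, 0) := by
    simp only [hσ, ha, Prod.mk.injEq, and_true]; abel
  -- linearity of `xt`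
  have hxt0 : ∀ v, xt v 0 = 0 := fun v => by rw [hxt, dif_pos rfl]
  have hxtne : ∀ v (j : {i : Λ L M // i ≠ 0}), xt v j.1 = v j := fun v j => by
    rw [hxt, dif_neg j.2]
  have hxt_add : ∀ v v' i, xt (v + v') i = xt v i + xt v' i := by
    intro v v' i
    by_cases hi : i = 0
    · subst hi; rw [hxt0, hxt0, hxt0, add_zero]
    · rw [hxt, hxt, hxt, dif_neg hi, dif_neg hi, dif_neg hi]; rfl
  have hxt_smul : ∀ (t : ℝ) v i, xt (t • v) i = t * xt v i := by
    intro t v i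
    by_cases hi : i = 0
    · subst hi; rw [hxt0, hxt0, mul_zero]
    · rw [hxt, hxt, dif_neg hi, dif_neg hi]; rfl
  -- the induced linear map on the pinned space
  let Φ : ({i : Λ L M // i ≠ 0} → ℝ) →ₗ[ℝ] ({i : Λ L M // i ≠ 0} → ℝ) :=
    { toFun := fun v j => xt v (σ j.1) - xt v (σ 0)
      map_add' := by
        intro v v'; funext j
        show xt (v + v') (σ j.1) - xt (v + v') (σ 0) =
          (xt v (σ j.1) - xt v (σ 0)) + (xt v' (σ j.1) - xt v' (σ 0))
        rw [hxt_add, hxt_add]; ring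
      map_smul' := by
        intro t v; funext j
        show xt (t • v) (σ j.1) - xt (t • v) (σ 0) = t * (xt v (σ j.1) - xt v (σ 0))
        rw [hxt_smul, hxt_smul]; ring }
  have hΦapply : ∀ v j, Φ v j = xt v (σ j.1) - xt v (σ 0) := fun v j => rfl
  have hxtΦ : ∀ v i, xt (Φ v) i = xt v (σ i) - xt v (σ 0) := by
    intro v i
    by_cases hi : i = 0
    · subst hi; rw [hxt0, sub_self]
    · rw [hxt (Φ v), dif_neg hi]
      rfl
  have hΦΦ : ∀ v, Φ (Φ v) = v := by
    intro v; funext j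
    rw [hΦapply, hxtΦ, hxtΦ, hσσ, hσσ, hxtne, hxt0]
    ring
  have hinvol : Function.Involutive Φ := hΦΦ
  -- `|det Φ| = 1`, so `Φ` preserves Lebesgue measure
  have hdet2 : LinearMap.det Φ * LinearMap.det Φ = 1 := by
    rw [← LinearMap.det_comp]
    have : Φ ∘ₗ Φ = LinearMap.id := LinearMap.ext fun v => hΦΦ v
    rw [this, LinearMap.det_id]
  have hdet : LinearMap.det Φ ≠ 0 := fun h => by
    rw [h, zero_mul] at hdet2; exact zero_ne_one hdet2
  have habs : |(LinearMap.det Φ)⁻¹| = 1 := by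
    rw [abs_inv]
    have h1 : |LinearMap.det Φ| * |LinearMap.det Φ| = 1 := by rw [← abs_mul, hdet2, abs_one]
    have h0 : 0 ≤ |LinearMap.det Φ| := abs_nonneg _
    have : |LinearMap.det Φ| = 1 := by nlinarith
    rw [this, inv_one]
  have hmap : Measure.map Φ (volume : Measure ({i : Λ L M // i ≠ 0} → ℝ)) = volume := by
    rw [Measure.map_linearMap_addHaar_eq_smul_addHaar
      (μ := (volume : Measure ({i : Λ L M // i ≠ 0} → ℝ))) hdet, habs, ENNReal.ofReal_one, one_smul]
  have hmp : MeasurePreserving Φ (volume : Measure ({i : Λ L M // i ≠ 0} → ℝ)) volume :=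
    ⟨Φ.continuous_of_finiteDimensional.measurable, hmap⟩
  have hme : MeasurableEmbedding Φ :=
    (LinearEquiv.ofInvolutive Φ hinvol).toContinuousLinearEquiv.toHomeomorph.measurableEmbedding
  -- the integrand and the core
  set C : Set ({i : Λ L M // i ≠ 0} → ℝ) := {v | ∀ s : Λ L M, ∑ w : W r, ∑ w' : W r,
      (xt v (sh L M s w) - xt v (sh L M s w')) ^ 2 ≤ a₀} with hC
  set g : ({i : Λ L M // i ≠ 0} → ℝ) → ℝ := fun v => (xt v (x, 0) - xt v (y, 0)) *
      Real.exp (-(K * ∑ s : Λ L M, (genF c (fun w => xt v (sh L M s w))).re)) with hg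
  -- invariance of the core
  have hpre : Φ ⁻¹' C = C := by
    ext v
    have h1 : ∀ s : Λ L M, (∑ w : W r, ∑ w' : W r,
        (xt (Φ v) (sh L M s w) - xt (Φ v) (sh L M s w')) ^ 2) =
        ∑ w : W r, ∑ w' : W r,
          (xt v (a - (sh L M s w).1, (sh L M s w).2) -
            xt v (a - (sh L M s w').1, (sh L M s w').2)) ^ 2 := by
      intro s
      refine Finset.sum_congr rfl fun w _ => Finset.sum_congr rfl fun w' _ => ?_
      rw [hxtΦ, hxtΦ]
      ring
    rw [Set.mem_preimage, hC, Set.mem_setOf_eq, Set.mem_setOf_eq]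
    simp only [h1]
    exact core_sinv_iff a (xt v) a₀
  -- anti-invariance of the integrand
  have hcomp : ∀ v, g (Φ v) = -g v := by
    intro v
    have hw : (∑ s : Λ L M, (genF c (fun w => xt (Φ v) (sh L M s w))).re) =
        ∑ s : Λ L M, (genF c (fun w => xt v (sh L M s w))).re := by
      have h2 : ∀ s : Λ L M, genF c (fun w => xt (Φ v) (sh L M s w)) =
          genF c (fun w => xt v (a - (sh L M s w).1, (sh L M s w).2)) := by
        intro s
        have : (fun w : W r => xt (Φ v) (sh L M s w)) =
            fun w : W r => xt v (a - (sh L M s w).1, (sh L M s w).2) + (-(xt v (σ 0))) := by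
          funext w; rw [hxtΦ]; ring
        rw [this]
        exact birAct_F_rotate c hU1 (F := genF c) (fun _ => rfl) _ _
      simp only [h2]
      have h3 := sum_genF_sinv c hP a (xt v)
      rw [← Complex.re_sum, ← Complex.re_sum, h3]
    show (xt (Φ v) (x, 0) - xt (Φ v) (y, 0)) *
        Real.exp (-(K * ∑ s : Λ L M, (genF c (fun w => xt (Φ v) (sh L M s w))).re)) =
      -((xt v (x, 0) - xt v (y, 0)) *
        Real.exp (-(K * ∑ s : Λ L M, (genF c (fun w => xt v (sh L M s w))).re)))
    rw [hw, hxtΦ, hxtΦ, hσx, hσy]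
    ring
  -- change of variables
  have hcv := hmp.setIntegral_preimage_emb hme g C
  rw [hpre] at hcv
  simp only [hcomp, integral_neg] at hcv
  show ∫ v in C, g v = 0
  linarith

/-- **Registered stub `stub_coreSecondMoment` (crux item stmt-HubbardSuperconductivity-14845,
line `log-concave-core-bounded-phase`; let-free).**  For `r ≥ 2`, `B`, `c₀ > 0` there is a core
threshold `a₀ > 0` such that for every (U1)+(N)+(A ≤ B)+(C)+(P) table, every `K > 0`, all
`2 ≤ L ≤ M` and all slice sites `x, y`, with `w = e^{−K Re A(ext v)}` the pinned modulus weight,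
`Core = {∀ s, ΣΣ((ext v)_{sh s w} − (ext v)_{sh s w'})² ≤ a₀}` and `h = (ext v)(x,0) − (ext v)(y,0)`:
`∫_Core h·w = 0` and `∫_Core h²·w ≤ 256/(K c₀) · ∫_Core w` — the full second moment of a slice
difference on the log-concave core is of spin-wave size, uniformly in the volume.
Proof: `stub_coreVarianceBL` (Brascamp–Lieb, variance) + `core_mean_zero` ((P)-symmetry, mean).
[cite: BrascampLieb1976, Thm 4.1] -/
theorem stub_coreSecondMoment : ∀ (r : ℕ) (B c₀ : ℝ), 2 ≤ r → 0 < c₀ → ∃ a₀ : ℝ, 0 < a₀ ∧ ∀ c : Table r, (∀ n ∈ c.support, ∑ w, n w = 0) → c.sum (fun _ a => a) = 0 → normA c ≤ B → (∀ φ : W r → ℝ, c₀ * ∑ w, ∑ w', (1 - Real.cos (φ w - φ w')) ≤ (genF c φ).re) → (∀ n : Freq r, c (fun w => n (Fin.rev w.1, Fin.rev w.2.1, w.2.2)) = c n) → ∀ K : ℝ, 0 < K → ∀ (L M : ℕ) [NeZero L] [NeZero M], 2 ≤ L → L ≤ M → ∀ x y : TorusSite 2 L, ∀ ext : ({i : Λ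 L M // i ≠ 0} → ℝ) → Λ L M → ℝ, (∀ v i, ext v i = if h : i = (0 : Λ L M) then (0 : ℝ) else v ⟨i, h⟩) → (∫ v in {v | ∀ s : Λ L M, ∑ w : W r, ∑ w' : W r, (ext v (sh L M s w) - ext v (sh L M s w')) ^ 2 ≤ a₀}, (ext v (x, 0) - ext v (y, 0)) * Real.exp (-(K * ∑ s : Λ L M, (genF c (fun w => ext v (sh L M s w))).re)) = 0) ∧ (∫ v in {v | ∀ s : Λ L M, ∑ w : W r, ∑ w' : W r, (ext v (sh L M s w) - ext v (sh L M s w')) ^ 2 ≤ a₀}, (ext v (x, 0) - ext v (y, 0)) ^ 2 * Real.exp (-(K * ∑ s : Λ L M, (genF c (fun w => ext v (sh L M s w))).re)) ≤ 256 / (K * c₀) * ∫ v in {v | ∀ s : Λ L M, ∑ w : W r, ∑ w' : W r, (ext v (sh L M s w) - ext v (sh L M s w')) ^ 2 ≤ a₀}, Real.exp (-(K * ∑ s : Λ L M, (genF c (fun w => ext v (sh L M s w))).re))) := by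
  intro r B c₀ hr hc₀
  obtain ⟨a₀, ha₀, hBL⟩ := stub_coreVarianceBL r B c₀ hr hc₀
  refine ⟨a₀, ha₀, ?_⟩
  intro c hU1 hN hA hC hP K hK L M _ _ hL hLM x y ext hext
  obtain ⟨hIw, -, hIh2, hvar⟩ := hBL c hU1 hN hA hC K hK L M hL hLM x y ext hext
  have hmean := core_mean_zero c hU1 hP K a₀ x y ext hext
  refine ⟨hmean, ?_⟩
  rw [hmean] at hvar
  simp only [ne_eq, OfNat.ofNat_ne_zero, not_false_eq_true, zero_pow, sub_zero] at hvar
  -- abbreviations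
  set C : Set ({i : Λ L M // i ≠ 0} → ℝ) := {v | ∀ s : Λ L M, ∑ w : W r, ∑ w' : W r,
      (ext v (sh L M s w) - ext v (sh L M s w')) ^ 2 ≤ a₀} with hCdef
  set wt : ({i : Λ L M // i ≠ 0} → ℝ) → ℝ := fun v =>
      Real.exp (-(K * ∑ s : Λ L M, (genF c (fun w => ext v (sh L M s w))).re)) with hwt
  have hwpos : ∀ v, 0 < wt v := fun v => Real.exp_pos _
  by_cases hCnull : volume C = 0
  · have hres : (volume : Measure ({i : Λ L M // i ≠ 0} → ℝ)).restrict C = 0 :=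
      Measure.restrict_eq_zero.2 hCnull
    show ∫ v in C, (ext v (x, 0) - ext v (y, 0)) ^ 2 * wt v ≤ 256 / (K * c₀) * ∫ v in C, wt v
    rw [hres, integral_zero_measure, integral_zero_measure, mul_zero]
  · have hIpos : 0 < ∫ v in C, wt v := by
      rw [integral_pos_iff_support_of_nonneg_ae (Filter.Eventually.of_forall fun v => (hwpos v).le)
        hIw]
      have hsupp : Function.support wt = Set.univ :=
        Set.eq_univ_of_forall fun v => (hwpos v).ne'
      rw [hsupp, Measure.restrict_apply MeasurableSet.univ, Set.univ_inter]
      exact pos_iff_ne_zero.2 hCnull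
    show ∫ v in C, (ext v (x, 0) - ext v (y, 0)) ^ 2 * wt v ≤ 256 / (K * c₀) * ∫ v in C, wt v
    have h := hvar
    -- `(∫ h² w)(∫ w) ≤ 256/(Kc₀) (∫ w)²`, divide by `∫ w > 0`
    have : (∫ v in C, (ext v (x, 0) - ext v (y, 0)) ^ 2 * wt v) * (∫ v in C, wt v) ≤
        (256 / (K * c₀) * ∫ v in C, wt v) * (∫ v in C, wt v) := by
      calc (∫ v in C, (ext v (x, 0) - ext v (y, 0)) ^ 2 * wt v) * (∫ v in C, wt v)
          ≤ 256 / (K * c₀) * (∫ v in C, wt v) ^ 2 := h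
        _ = (256 / (K * c₀) * ∫ v in C, wt v) * (∫ v in C, wt v) := by ring
    exact le_of_mul_le_mul_right this hIpos

end Pinned

end CoreBL

end Summit.HubbardSuperconductivity.HubbardSuperconductivity.Theorems

end
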